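import Literature.Computability.AlgebraicComplexity.DeterminantalComplexityProofs
import Literature.Computability.AlgebraicComplexity.StandardFamiliesProofs
import Summits.ValiantsHypothesis.ValiantsHypothesis.Theorems.DetQPDetqpThesisStubNormalForm
import Summits.ValiantsHypothesis.ValiantsHypothesis.Theorems.DetQPDetqpThesisStubDeletion
import Summits.ValiantsHypothesis.ValiantsHypothesis.Theorems.DetQPDetqpThesisStubTelescope

/-!
# `DetqpThesis` (stmt-ValiantsHypothesis-0315), line `fat-row-recursion` — calibration of the bet
# S3 from BELOW: fat blocks force an `exp(N^ε)`-type lower bound for `dc(per_N)`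

A ROW-PARTITIONED affine determinantal representation of `per_n = perPoly (Fin n) ℂ` of size `M`
is an affine determinantal representation `A` (`IsAffineDetRepr`) together with
`β : Fin M → Fin n` such that matrix row `a` reads only the variables `X (•, β a)`; block `c` is
`{a | β a = c}`.  The line's bet S3 (`stub_fatBlock`) says: for some `ε > 0` and all large `n`,
SOME row-partitioned representation of `per_n` of minimal size `M` has a block of size
`≥ M / n^{1-ε}`.

`stub_expLower_of_fatBlock` (registered calibration stub S8, lead a1): the bet implies, for some
`0 < ε ≤ 1` and `n₀`, the EVENTUAL bound `exp(((N+1)^ε − (n₀+1)^ε)/ε) ≤ N · dc(per_N)` for all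
`N ≥ n₀` — an exponential-type lower bound for the determinantal complexity of the permanent, far
beyond every known engine (the record is Mignon–Ressayre's `n²/2`).  The proof is the line's own
composition, run in tree vocabulary: with `r(n)` the least size of a row-partitioned representation
(`sInf`, written inline), minimality in S3 pins `M = r(n+1)`, the deletion surgery S2
(`FatRowDeletion.stub_deletion`) gives `r(n) ≤ r(n+1) − u_j`, so the fat block yields the growth law
`r(n+1) ≤ (n+1)^{1-ε}·(r(n+1) − r(n))`; the telescoping bound `FatRowTelescope.exp_telescope_le`
(S4) gives `exp(…) ≤ r(N)`, and the normal form S1 (`FatRowNormalForm.stub_normalForm`) gives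
`r(N) ≤ N·dc(per_N)`.  Together with the upper sandwich
(`FatRowCalibration.stub_fatBlock_of_grenetTight`: eventual Grenet-tightness ⇒ the bet for every
`ε < 1/2`) this calibrates S3 as an exponential-regime statement on both sides: not a stub a prover
can close, and not one a disprover can kill short of beating Grenet's `2ⁿ − 1` infinitely often.

Sources: the line card `Cruxes/DetqpThesis/Lines/fat-row-recursion.md`; T. Mignon, N. Ressayre
(2004) for the quadratic record; B. Grenet (2011) for `2ⁿ − 1`.  Not here: the bet itself.
-/

-- single-conjunct layout: Sub = Summit, duplicated namespace component intended
set_option linter.dupNamespace false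

noncomputable section

namespace Summit.ValiantsHypothesis.ValiantsHypothesis.Theorems.DetQPDetqpThesis.FatRowExpLower

open MvPolynomial Finset
open Literature.Computability.AlgebraicComplexity

/-- **Registered calibration stub `stub_expLower_of_fatBlock` (S8): the bet S3 forces an
`exp(N^ε)`-type lower bound for `dc(per_N)`.**  Hypothesis: verbatim the registered bet
`stub_fatBlock` (∃-form `IC∃(ε)`).  Conclusion: for some `0 < ε` (in fact `min ε 1`) and `n₀`,
`exp(((N+1)^ε − (n₀+1)^ε)/ε) ≤ N · dc(per_N)` for every `N ≥ n₀`.  Proof: S3-minimality + S2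
(deletion) ⇒ growth law for the row-partitioned complexity `r`; S4 (telescope) ⇒ `exp(…) ≤ r(N)`;
S1 (normal form) ⇒ `r(N) ≤ N·dc(per_N)`. [folklore] -/
theorem stub_expLower_of_fatBlock :
    (∃ ε : ℝ, 0 < ε ∧ ∃ n₀ : ℕ, ∀ n ≥ n₀,
      ∃ (M : ℕ) (A : Matrix (Fin M) (Fin M) (MvPolynomial (Fin n × Fin n) ℂ)) (β : Fin M → Fin n),
        IsAffineDetRepr (perPoly (Fin n) ℂ) A ∧
        (∀ a b (e : Fin n × Fin n), coeff (Finsupp.single e 1) (A a b) ≠ 0 → e.2 = β a) ∧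
        (∀ M' < M, ¬ ∃ (A' : Matrix (Fin M') (Fin M') (MvPolynomial (Fin n × Fin n) ℂ))
            (β' : Fin M' → Fin n),
            IsAffineDetRepr (perPoly (Fin n) ℂ) A' ∧
            ∀ a b (e : Fin n × Fin n), coeff (Finsupp.single e 1) (A' a b) ≠ 0 → e.2 = β' a) ∧
        ∃ j : Fin n, (M : ℝ) ≤ (n : ℝ) ^ (1 - ε) * ((Finset.univ.filter fun a => β a = j).card : ℝ)) →
    ∃ ε : ℝ, 0 < ε ∧ ∃ n₀ : ℕ, ∀ N ≥ n₀,
      Real.exp ((((N : ℝ) + 1) ^ ε - ((n₀ : ℝ) + 1) ^ ε) / ε) ≤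
        (N : ℝ) * (determinantalComplexity (perPoly (Fin N) ℂ) : ℝ) := by
  classical
  rintro ⟨ε, hε, n₀, hfat⟩
  -- the sizes of row-partitioned representations of `per_n`, and their minimum `r(n)`, inline
  set S : (n : ℕ) → Set ℕ := fun n => {M : ℕ |
      ∃ (A : Matrix (Fin M) (Fin M) (MvPolynomial (Fin n × Fin n) ℂ)) (β : Fin M → Fin n),
        IsAffineDetRepr (perPoly (Fin n) ℂ) A ∧
        ∀ a b (e : Fin n × Fin n), coeff (Finsupp.single e 1) (A a b) ≠ 0 → e.2 = β a} with hS
  set r : ℕ → ℕ := fun n => sInf (S n) with hr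
  -- S1: `r(n)` is attained and `r(n) ≤ n · dc(per_n)` (`n ≥ 1`)
  have hS1 : ∀ n, 1 ≤ n → r n ∈ S n ∧ r n ≤ n * determinantalComplexity (perPoly (Fin n) ℂ) := by
    intro n hn
    obtain ⟨M, hM, hRP⟩ := FatRowNormalForm.stub_normalForm n
      (determinantalComplexity (perPoly (Fin n) ℂ)) hn (hasDetRepr_determinantalComplexity_holds _)
    have hRP' : M ∈ S n := hRP
    exact ⟨Nat.sInf_mem ⟨M, hRP'⟩, (Nat.sInf_le hRP').trans hM⟩
  -- `n ≤ dc(per_n) ≤ r(n)`, so `1 ≤ r(n)` for `n ≥ 1`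
  have hr1 : ∀ n, 1 ≤ n → 1 ≤ r n := by
    intro n hn
    obtain ⟨⟨A, β, hA, -⟩, -⟩ := hS1 n hn
    have h1 : determinantalComplexity (perPoly (Fin n) ℂ) ≤ r n :=
      determinantalComplexity_le_of_hasDetRepr ⟨A, hA⟩
    have h2 : n ≤ determinantalComplexity (perPoly (Fin n) ℂ) := by
      have h := totalDegree_le_determinantalComplexity_holds (perPoly (Fin n) ℂ)
      rwa [totalDegree_perPoly_holds, Fintype.card_fin] at h
    omega
  -- the growth law with `ε' = min ε 1`, for `n ≥ n₁ := max n₀ 1`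
  set ε' : ℝ := min ε 1 with hε'_def
  have hε' : 0 < ε' := lt_min hε one_pos
  have hε'1 : ε' ≤ 1 := min_le_right _ _
  set n₁ : ℕ := max n₀ 1 with hn₁_def
  have hG : ∀ n ≥ n₁,
      (r (n + 1) : ℝ) ≤ ((n + 1 : ℕ) : ℝ) ^ (1 - ε') * ((r (n + 1) : ℝ) - (r n : ℝ)) := by
    intro n hn
    have hn₀ : n₀ ≤ n := le_trans (le_max_left _ _) hn
    have hn1 : 1 ≤ n := le_trans (le_max_right _ _) hn
    obtain ⟨M, A, β, hA, hβ, hmin, j, hj⟩ := hfat (n + 1) (by omega)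
    have hRP : M ∈ S (n + 1) := ⟨A, β, hA, hβ⟩
    have hle : r (n + 1) ≤ M := Nat.sInf_le hRP
    have hge : M ≤ r (n + 1) := by
      by_contra hlt
      push Not at hlt
      have hmem : r (n + 1) ∈ S (n + 1) := Nat.sInf_mem ⟨M, hRP⟩
      exact hmin (r (n + 1)) hlt hmem
    have hM : r (n + 1) = M := le_antisymm hle hge
    obtain ⟨M', hM', hRP'⟩ := FatRowDeletion.stub_deletion n hn1 M A β hA hβ j
    have hRP'' : M' ∈ S n := hRP'
    have hrn : r n ≤ M' := Nat.sInf_le hRP''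
    have hsum : r n + (Finset.univ.filter fun a => β a = j).card ≤ r (n + 1) := by omega
    have hcast : ((Finset.univ.filter fun a => β a = j).card : ℝ) ≤ (r (n + 1) : ℝ) - (r n : ℝ) := by
      have h := (Nat.cast_le (α := ℝ)).mpr hsum
      push_cast at h
      linarith
    -- weaken the exponent: `(n+1)^(1-ε) ≤ (n+1)^(1-ε')`
    have hbase : (1 : ℝ) ≤ ((n + 1 : ℕ) : ℝ) := by exact_mod_cast Nat.le_add_left 1 n
    have hexp : ((n + 1 : ℕ) : ℝ) ^ (1 - ε) ≤ ((n + 1 : ℕ) : ℝ) ^ (1 - ε') :=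
      Real.rpow_le_rpow_of_exponent_le hbase (by linarith [min_le_left ε 1])
    have hpow : (0 : ℝ) ≤ ((n + 1 : ℕ) : ℝ) ^ (1 - ε') := Real.rpow_nonneg (Nat.cast_nonneg _) _
    have hcard0 : (0 : ℝ) ≤ ((Finset.univ.filter fun a => β a = j).card : ℝ) := Nat.cast_nonneg _
    calc (r (n + 1) : ℝ) = (M : ℝ) := by rw [hM]
      _ ≤ ((n + 1 : ℕ) : ℝ) ^ (1 - ε) * ((Finset.univ.filter fun a => β a = j).card : ℝ) := hj
      _ ≤ ((n + 1 : ℕ) : ℝ) ^ (1 - ε') * ((Finset.univ.filter fun a => β a = j).card : ℝ) :=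
          mul_le_mul_of_nonneg_right hexp hcard0
      _ ≤ ((n + 1 : ℕ) : ℝ) ^ (1 - ε') * ((r (n + 1) : ℝ) - (r n : ℝ)) :=
          mul_le_mul_of_nonneg_left hcast hpow
  -- telescope (S4's lemma) and `r ≤ N · dc`
  have htel := FatRowTelescope.exp_telescope_le r hε' hε'1 n₁ (hr1 n₁ (le_max_right _ _)) hG
  refine ⟨ε', hε', n₁, fun N hN => ?_⟩
  have hN1 : 1 ≤ N := le_trans (le_max_right _ _) hN
  have h2 := (hS1 N hN1).2
  have h2R : (r N : ℝ) ≤ (N : ℝ) * (determinantalComplexity (perPoly (Fin N) ℂ) : ℝ) := by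
    exact_mod_cast h2
  exact (htel N hN).trans h2R

end Summit.ValiantsHypothesis.ValiantsHypothesis.Theorems.DetQPDetqpThesis.FatRowExpLower

end
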